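import Mathlib
import Literature.NumberTheory.EllipticCurves.IwasawaAlgebra

/-!
# Sketch — crux idea `fe-chromatic-twist` for `stmt-BirchSwinnertonDyer-19875`
# (`SprungLowerDivisibilityAtThree`), aimed at stub S0 `stub_bothColours` of line `chromatic_common_zeros`

The logical kernel of the lever, fully proved over an ABSTRACT half-logarithm matrix `LL`, an abstract
involution `ι` (in the application: `T ↦ (1+T)⁻¹ - 1`, `PowerSeries.subst` of
`Literature.Barriers.BirchSwinnertonDyer.invOnePlusSubOne`) and an abstract functional-equation
multiplier `κ` (in the application: `-c_N (1+T)^{-log_γ N}`, Mazur–Tate–Teitelbaum §I.17).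
The two inputs left as hypotheses are exactly the card's requests:
(F)  `TraceCoordinateFE`  — MTT functional equation of `L_α`, `L_β` ⊕ Sprung's decomposition
     `(L_α, L_β) = (L♯, L♭) · Log_{α,β}`, written α-free in "trace coordinates";
(W)  `ChromaticWronskianNonvanishing` — the universal computation `coeff_T(D♯) = ±1/21`,
     `coeff_T(D♭) = ±3/7` at `(p, a_p) = (3, ±3)` (exact arithmetic: `fe/fe_twist_check.py`).
BSD / K1 are NOT proved here; this feeds stub S0 of a CLASS route (D-0152).
-/

set_option linter.dupNamespace false
noncomputable section
namespace Summit.BirchSwinnertonDyer.BirchSwinnertonDyer.Cruxes.SprungLowerDivisibilityAtThree.FeChromaticTwist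

open PowerSeries

/-- **Twist criterion (algebraic kernel).** In a domain with an injective endomorphism `ι`: if one
non-zero `Ls` carries BOTH `l₁` and `l₂` through the same functional equation with multiplier `κ ≠ 0`,
then the pair `(l₁, l₂)` is projectively `ι`-invariant: `l₁ · ι l₂ = l₂ · ι l₁`. -/
theorem twist_criterion {R : Type*} [CommRing R] [IsDomain R] (ι : R →+* R)
    (hι : Function.Injective ι) {κ Ls l₁ l₂ : R} (hκ : κ ≠ 0) (hLs : Ls ≠ 0)
    (h₁ : Ls * l₁ = κ * (ι Ls * ι l₁)) (h₂ : Ls * l₂ = κ * (ι Ls * ι l₂)) :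
    l₁ * ι l₂ = l₂ * ι l₁ := by
  have hιLs : ι Ls ≠ 0 := (map_ne_zero_iff ι hι).mpr hLs
  have key : κ * ι Ls * (l₁ * ι l₂ - l₂ * ι l₁) = 0 := by
    linear_combination l₂ * h₁ - l₁ * h₂
  rcases mul_eq_zero.mp key with h | h
  · rcases mul_eq_zero.mp h with h' | h'
    · exact absurd h' hκ
    · exact absurd h' hιLs
  · exact sub_eq_zero.mp h

/-- The coefficient embedding `Λ = ℤ₃⟦T⟧ → ℚ₃⟦T⟧`. -/
abbrev toRat : Literature.NumberTheory.EllipticCurves.IwasawaAlgebra 3 →+* PowerSeries ℚ_[3] :=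
  PowerSeries.map (PadicInt.Coe.ringHom (p := 3))

theorem toRat_injective : Function.Injective toRat :=
  PowerSeries.map_injective _ Subtype.coe_injective

/-- **(F) requested named fact, abstract shape.** The two α-free "trace coordinates"
`G_j := L♯ · LL 0 j + L♭ · LL 1 j` (`j = 0, 1`) of `(L_α, L_β) = (L♯, L♭) · LL · C · [[-1,-1],[β,α]]`
satisfy ONE scalar functional equation `G_j = κ · ι(G_j)` with the SAME `κ` (MTT §I.17 for `L_α` and
`L_β`; Sprung 2012 Thm 1.1 / 2017 Thm 1.2(a) for the decomposition; `LL = lim 𝒞₁⋯𝒞ₙ C^{-(n+2)}`). -/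
def TraceCoordinateFE (ι : PowerSeries ℚ_[3] →+* PowerSeries ℚ_[3])
    (LL : Matrix (Fin 2) (Fin 2) (PowerSeries ℚ_[3])) (κ : PowerSeries ℚ_[3])
    (Ls Lf : Literature.NumberTheory.EllipticCurves.IwasawaAlgebra 3) : Prop :=
  ∀ j : Fin 2, toRat Ls * LL 0 j + toRat Lf * LL 1 j = κ * ι (toRat Ls * LL 0 j + toRat Lf * LL 1 j)

/-- The `ι`-Wronskian of a row of `LL`: `D_r := LL r 0 · ι(LL r 1) - LL r 1 · ι(LL r 0)`
(`r = 0`: `D♯`, `r = 1`: `D♭`). It vanishes at `T = 0` and at every cyclotomic point; its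
`T`-coefficient is `2 · W_r`, `W_r` the ordinary Wronskian of the row at `T = 0`. -/
def rowTwist (ι : PowerSeries ℚ_[3] →+* PowerSeries ℚ_[3])
    (LL : Matrix (Fin 2) (Fin 2) (PowerSeries ℚ_[3])) (r : Fin 2) : PowerSeries ℚ_[3] :=
  LL r 0 * ι (LL r 1) - LL r 1 * ι (LL r 0)

/-- **(W) the universal computation, abstract shape**: both row twists have non-zero `T`-coefficient
(at `(3, ±3)`: `coeff_T D♯ = ±1/21`, `coeff_T D♭ = ±3/7`, closed form via `C^6 = -27·I`). -/
def ChromaticWronskianNonvanishing (ι : PowerSeries ℚ_[3] →+* PowerSeries ℚ_[3])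
    (LL : Matrix (Fin 2) (Fin 2) (PowerSeries ℚ_[3])) : Prop :=
  coeff 1 (rowTwist ι LL 0) ≠ 0 ∧ coeff 1 (rowTwist ι LL 1) ≠ 0

/-- **First lemma of the line (proved): (F) ∧ (W) ∧ "not both zero" ⟹ both colours non-zero.**
"Not both zero" is the tree theorem `IsSprungPair.ne_zero_or_ne_zero` (Sprung 2012 Prop. 6.14 via
Rohrlich); `κ ≠ 0` since `κ(0) = ±1`; `ι` injective since it is an involution. -/
theorem both_ne_zero (ι : PowerSeries ℚ_[3] →+* PowerSeries ℚ_[3]) (hι : Function.Injective ι)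
    (LL : Matrix (Fin 2) (Fin 2) (PowerSeries ℚ_[3])) {κ : PowerSeries ℚ_[3]} (hκ : κ ≠ 0)
    {Ls Lf : Literature.NumberTheory.EllipticCurves.IwasawaAlgebra 3}
    (hFE : TraceCoordinateFE ι LL κ Ls Lf) (hW : ChromaticWronskianNonvanishing ι LL)
    (hR : Ls ≠ 0 ∨ Lf ≠ 0) : Ls ≠ 0 ∧ Lf ≠ 0 := by
  -- one colour zero ⟹ the other row of `LL` is projectively `ι`-invariant ⟹ its twist vanishes
  have sharp_case : Lf = 0 → Ls ≠ 0 → False := by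
    intro hf hs
    have hs' : toRat Ls ≠ 0 := (map_ne_zero_iff _ toRat_injective).mpr hs
    have h := fun j ↦ hFE j
    simp only [hf, map_zero, zero_mul, add_zero, map_mul] at h
    have htw := twist_criterion ι hι hκ hs' (h 0) (h 1)
    apply hW.1
    simp [rowTwist, htw]
  have flat_case : Ls = 0 → Lf ≠ 0 → False := by
    intro hs hf
    have hf' : toRat Lf ≠ 0 := (map_ne_zero_iff _ toRat_injective).mpr hf
    have h := fun j ↦ hFE j
    simp only [hs, map_zero, zero_mul, zero_add, map_mul] at h
    have htw := twist_criterion ι hι hκ hf' (h 0) (h 1)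
    apply hW.2
    simp [rowTwist, htw]
  by_cases hs : Ls = 0
  · exact (flat_case hs (hR.resolve_left (not_ne_iff.mpr hs))).elim
  by_cases hf : Lf = 0
  · exact (sharp_case hf hs).elim
  · exact ⟨hs, hf⟩

end Summit.BirchSwinnertonDyer.BirchSwinnertonDyer.Cruxes.SprungLowerDivisibilityAtThree.FeChromaticTwist

end
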